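import Summits.ResolutionOfSingularities.ResolutionOfSingularities.Theorems.EquisingularLiftEquisingularLiftNatNoseThenPointsOfLiftableCentre
import HarnessLib

/-!
# [OURS · L1 W4.5(b) · EL♮(3)] «LIFTABLE NOSE OVER A GIVEN DVR, THEN POINTS» — the ∃-O / given-O variant of lead-2's closer p525611

Cell `res-hironaka`, rung L, slot W4.5(b); crux **EL♮(3)** (stmt-ResolutionOfSingularities-20148) / EL♮ (stmt-20038); non-isolated residue
`stub_elnat_three_nonisolated_nonliftclass` (skeleton v12 / child v10). res-L1-w45b-plan-1 CHAIN v7.14 §1 (6) / WORDS 13:35:14Z (2): «EL♮ is ∃-O but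
`IsLiftableCentre` (p530164) is ∀-O and the closer instantiates `stub_wittRing`; … a closer `elnat_noseThenPoints_of_liftableCentreOver` (p525611 re-run
over one given complete DVR O of char 0 with O ↠ k = k̄; S/M-sized, 051 or the lead)». OURS; NOT a statement of any manuscript; AI-written, weaker
than expert review. No definition, no `sorry`, standard axioms. `--supports stmt-ResolutionOfSingularities-20148 --as helper`; closes nothing.

WHAT. `elnat_noseThenPoints_of_liftableCentreOver`: the statement of `elnat_noseThenPoints_of_liftableCentre` (p525611) with the ∀-O hypothesis
hLIFT replaced by ONE GIVEN `O₀` — a COMPLETE DVR of characteristic `0` with algebraically closed residue field and a surjection `π₀ : O₀ ↠ k` (the instance package of the hLIFT quantifier plus `CharZero`)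
— and ONE centre `C ⊂ ℙⁿ_{O₀}` with `V(C) → Spec O₀` SMOOTH and exact trace `𝓘_Z` along every graded `φ` over `π₀`; the horizontal EL♮ conclusion is
then witnessed OVER `O₀` itself. Use: ramified-only liftable classes (liaison lifts over `W(k)[√ϖ]`, modular lifts over `W(k)[ζ_p]`, …) enter the
nose-then-points interface with their own `O₀`, and the successor class `IsLiftableNoseClass₂` can carry an `IsLiftableCentreOver`-type constructor.
PROOF = p525611's, minus `stub_wittRing`: res-type-051's (HORIZ) supplier `ciNose_horizSupplier` (p518249) is already stated for an arbitrary DVR.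

References: as p525611 (Hartshorne II 7, III 9–10 [Hartshorne1977]; Stacks 01V8 [StacksProject]); cell: CHAIN w45b v7.14 §1 (6) (index only, OURS).
-/

set_option linter.dupNamespace false
set_option linter.overlappingInstances false -- `[IsDomain O₀] [IsDiscreteValuationRing O₀]` as in the EL♮ conclusion

open CategoryTheory AlgebraicGeometry TopologicalSpace
open AlgebraicGeometry.Scheme.IdealSheafData
open Summit.ResolutionOfSingularities.ResolutionOfSingularities.Cruxes.EquisingularLift.StrataSplit

namespace Summit.ResolutionOfSingularities.ResolutionOfSingularities.Cruxes.EquisingularLiftNat.Sections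

/-- **Liftable nose OVER A GIVEN DVR, then points ⇒ horizontal EL♮** (any `p`, `k = k̄`, `n`): as `elnat_noseThenPoints_of_liftableCentre`
(p525611) but with ONE given complete DVR `O₀` of characteristic `0`, `π₀ : O₀ ↠ k`, and ONE `O₀`-smooth centre `C ⊂ ℙⁿ_{O₀}` with trace `𝓘_Z` along
every graded `φ` over `π₀`, in place of the ∀-O hypothesis hLIFT; the conclusion's `∃ O` is witnessed by `O₀`.
[folklore; assembly of p517086/p518249, cf. p525611] -/
theorem elnat_noseThenPoints_of_liftableCentreOver (p : ℕ) : p.Prime → ∀ (k : Type) [Field k] [CharP k p] [IsAlgClosed k] (n : ℕ) (H : AlgebraicGeometry.Scheme.{0}) (ι : H ⟶ (Literature.AlgebraicGeometry.Motives.projectiveSpace n k).left), AlgebraicGeometry.IsClosedImmersion ι → AlgebraicGeometry.IsIntegral H → (∀ y : (Literature.AlgebraicGeometry.Motives.projectiveSpace n k).left, ∃ U : (Literature.AlgebraicGeometry.Motives.projectiveSpace n k).left.affineOpens, y ∈ (U : (Literature.AlgebraicGeometry.Motives.projectiveSpace n k).left.Opens) ∧ (ι.ker.ideal U).IsPrincipal)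 → ∀ (Z : Set (Literature.AlgebraicGeometry.Motives.projectiveSpace n k).left) (hSig : IsClosed Z), Z ⊆ Set.range ι → ¬ (Set.range ι ⊆ Z) → ∀ (O₀ : Type) [CommRing O₀] [IsDomain O₀] [IsDiscreteValuationRing O₀] [IsAdicComplete (IsLocalRing.maximalIdeal O₀) O₀] [IsAlgClosed (IsLocalRing.ResidueField O₀)] [CharZero O₀] (π₀ : O₀ →+* k), Function.Surjective π₀ → (letI := MvPolynomial.gradedAlgebra (σ := Fin (n + 1)) (R := O₀); letI := MvPolynomial.gradedAlgebra (σ := Fin (n + 1)) (R := k); ∀ C : (AlgebraicGeometry.Proj (MvPolynomial.homogeneousSubmodule (Fin (n + 1)) O₀)).IdealSheafData, AlgebraicGeometry.Smooth (CategoryTheory.CategoryStruct.comp C.subschemeι (CategoryTheory.CategoryStruct.comp (AlgebraicGeometry.Proj.toSpecZero (MvPolynomial.homogeneousSubmodule (Fin (n + 1)) O₀)) (AlgebraicGeometry.Spec.map (CommRingCat.ofHom (algebraMap O₀ ((MvPolynomial.homogeneousSubmodule (Fin (n + 1)) O₀) 0)))))) → (∀ (φ : (MvPolynomial.homogeneousSubmodule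 (Fin (n + 1)) O₀) →+*ᵍ (MvPolynomial.homogeneousSubmodule (Fin (n + 1)) k)) (hφ' : HomogeneousIdeal.irrelevant (MvPolynomial.homogeneousSubmodule (Fin (n + 1)) k) ≤ (HomogeneousIdeal.irrelevant (MvPolynomial.homogeneousSubmodule (Fin (n + 1)) O₀)).map φ), (∀ s, φ s = MvPolynomial.map π₀ s) → C.comap (AlgebraicGeometry.Proj.map φ hφ') = AlgebraicGeometry.Scheme.IdealSheafData.vanishingIdeal (⟨Z, hSig⟩ : TopologicalSpace.Closeds (Literature.AlgebraicGeometry.Motives.projectiveSpace n k).left)) → (∃ (F₂ : AlgebraicGeometry.Scheme.{0}) (υ : F₂ ⟶ (Literature.AlgebraicGeometry.Motives.projectiveSpace n k).left), Literature.AlgebraicGeometry.Resolution.IsBlowup υ (AlgebraicGeometry.Scheme.IdealSheafData.vanishingIdeal (⟨Z, hSig⟩ : TopologicalSpace.Closeds (Literature.AlgebraicGeometry.Motives.projectiveSpace n k).left)) ∧ ∃ (F' : AlgebraicGeometry.Scheme.{0}) (ρ' : F' ⟶ F₂) (T' : Set F'), (∀ Q : (∀ F₁ : AlgebraicGeometry.Scheme.{0},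 (F₁ ⟶ F₂) → Set F₁ → Prop), Q F₂ (CategoryTheory.CategoryStruct.id F₂) (closure (υ ⁻¹' (Set.range ι \ Z))) → (∀ (F₁ F₃ : AlgebraicGeometry.Scheme.{0}) (ρ : F₁ ⟶ F₂) (T₁ : Set F₁) (x : ↥((AlgebraicGeometry.Scheme.IdealSheafData.vanishingIdeal (⟨closure T₁, isClosed_closure⟩ : TopologicalSpace.Closeds F₁))).subscheme) (υ₁ : F₃ ⟶ F₁) (hx : IsClosed ({(((AlgebraicGeometry.Scheme.IdealSheafData.vanishingIdeal (⟨closure T₁, isClosed_closure⟩ : TopologicalSpace.Closeds F₁))).subschemeι x : F₁)} : Set F₁)), Q F₁ ρ T₁ → ¬ IsRegularLocalRing (((AlgebraicGeometry.Scheme.IdealSheafData.vanishingIdeal (⟨closure T₁, isClosed_closure⟩ : TopologicalSpace.Closeds F₁))).subscheme.presheaf.stalk x) → Literature.AlgebraicGeometry.Resolution.IsBlowup υ₁ (AlgebraicGeometry.Scheme.IdealSheafData.vanishingIdeal (⟨{(((AlgebraicGeometry.Scheme.IdealSheafData.vanishingIdeal (⟨closure T₁, isClosed_closure⟩ : TopologicalSpace.Closeds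 F₁))).subschemeι x : F₁)}, hx⟩ : TopologicalSpace.Closeds F₁)) → Q F₃ (CategoryTheory.CategoryStruct.comp υ₁ ρ) (closure (υ₁ ⁻¹' (T₁ \ {(((AlgebraicGeometry.Scheme.IdealSheafData.vanishingIdeal (⟨closure T₁, isClosed_closure⟩ : TopologicalSpace.Closeds F₁))).subschemeι x : F₁)})))) → Q F' ρ' T') ∧ Literature.AlgebraicGeometry.Resolution.Scheme.IsRegular (AlgebraicGeometry.Scheme.IdealSheafData.vanishingIdeal (⟨closure T', isClosed_closure⟩ : TopologicalSpace.Closeds F')).subscheme) → ∃ (O : Type) (_ : CommRing O) (_ : IsDomain O) (_ : IsDiscreteValuationRing O) (_ : CharZero O) (π : O →+* k), Function.Surjective π ∧ (letI := MvPolynomial.gradedAlgebra (σ := Fin (n + 1)) (R := O); letI := MvPolynomial.gradedAlgebra (σ := Fin (n + 1)) (R := k); ∀ (φ : MvPolynomial.homogeneousSubmodule (Fin (n + 1)) O →+*ᵍ MvPolynomial.homogeneousSubmodule (Fin (n + 1)) k) (hφ' : HomogeneousIdeal.irrelevant (MvPolynomial.homogeneousSubmodule (Fin (n + 1)) k) ≤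 (HomogeneousIdeal.irrelevant (MvPolynomial.homogeneousSubmodule (Fin (n + 1)) O)).map φ), (∀ s, φ s = MvPolynomial.map π s) → ∀ Y : Set (AlgebraicGeometry.Proj (MvPolynomial.homogeneousSubmodule (Fin (n + 1)) O)), Y = Set.range (CategoryTheory.CategoryStruct.comp ι (AlgebraicGeometry.Proj.map φ hφ') : H ⟶ (AlgebraicGeometry.Proj (MvPolynomial.homogeneousSubmodule (Fin (n + 1)) O))) → ∃ (P' : AlgebraicGeometry.Scheme.{0}) (σ : P' ⟶ (AlgebraicGeometry.Proj (MvPolynomial.homogeneousSubmodule (Fin (n + 1)) O))) (S' : Set P'), (∀ Q : (∀ X' : AlgebraicGeometry.Scheme.{0}, (X' ⟶ (AlgebraicGeometry.Proj (MvPolynomial.homogeneousSubmodule (Fin (n + 1)) O))) → Set X' → Prop), Q (AlgebraicGeometry.Proj (MvPolynomial.homogeneousSubmodule (Fin (n + 1)) O)) (CategoryTheory.CategoryStruct.id (AlgebraicGeometry.Proj (MvPolynomial.homogeneousSubmodule (Fin (n + 1)) O))) Y → (∀ (X' X'' : AlgebraicGeometry.Scheme.{0}) (σ' : X' ⟶ (AlgebraicGeometry.Proj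 (MvPolynomial.homogeneousSubmodule (Fin (n + 1)) O))) (Y' : Set X') (C : X'.IdealSheafData) (τ : X'' ⟶ X'), Q X' σ' Y' → Literature.AlgebraicGeometry.Resolution.IsBlowup τ C → Literature.AlgebraicGeometry.Resolution.Scheme.IsRegular C.subscheme → AlgebraicGeometry.Flat (CategoryTheory.CategoryStruct.comp C.subschemeι (CategoryTheory.CategoryStruct.comp σ' (CategoryTheory.CategoryStruct.comp (AlgebraicGeometry.Proj.toSpecZero (MvPolynomial.homogeneousSubmodule (Fin (n + 1)) O)) (AlgebraicGeometry.Spec.map (CommRingCat.ofHom (algebraMap O (MvPolynomial.homogeneousSubmodule (Fin (n + 1)) O 0))))))) → σ' '' (C.support : Set X') ⊆ {x | ¬ IsGenericPoint x Y} → (C.support : Set X') ∩ (CategoryTheory.CategoryStruct.comp σ' (CategoryTheory.CategoryStruct.comp (AlgebraicGeometry.Proj.toSpecZero (MvPolynomial.homogeneousSubmodule (Fin (n + 1)) O)) (AlgebraicGeometry.Spec.map (CommRingCat.ofHom (algebraMap O (MvPolynomial.homogeneousSubmodule (Fin (n + 1)) O 0)))))) ⁻¹' {IsLocalRing.closedPoint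 O} ⊆ Y' → Q X'' (CategoryTheory.CategoryStruct.comp τ σ') (closure (τ ⁻¹' (Y' \ (C.support : Set X'))))) → Q P' σ S') ∧ Literature.AlgebraicGeometry.Resolution.Scheme.IsRegular (AlgebraicGeometry.Scheme.IdealSheafData.vanishingIdeal (⟨closure S', isClosed_closure⟩ : TopologicalSpace.Closeds P')).subscheme)):= by
  classical
  intro hp k _ _ _ n H ι hι hH hloc Z hSig hsub hnsub O₀ _ _ _ _ _ _ π₀ hπ₀ C hCsm hKEY hdown
  obtain ⟨F₂, υ, hυ, hdown⟩ := hdown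
  refine ⟨O₀, inferInstance, inferInstance, inferInstance, inferInstance, π₀, hπ₀, ?_⟩
  intro φ hφ' hφ Y hY
  have hK := hKEY φ hφ' hφ
  refine ciNose_horizSupplier k n H ι hι hH O₀ π₀ hπ₀ φ hφ' hφ C hCsm ?_ ?_ ?_ Y hY
  · rw [hK]; erw [AlgebraicGeometry.Scheme.IdealSheafData.coe_support_vanishingIdeal]; exact hnsub
  · rw [hK]; erw [AlgebraicGeometry.Scheme.IdealSheafData.coe_support_vanishingIdeal]; exact hsub
  · refine ⟨F₂, υ, ?_, ?_⟩
    · rw [hK]; exact hυ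
    · rw [hK]; erw [AlgebraicGeometry.Scheme.IdealSheafData.coe_support_vanishingIdeal]; exact hdown

end Summit.ResolutionOfSingularities.ResolutionOfSingularities.Cruxes.EquisingularLiftNat.Sections
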